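import Literature.MathematicalPhysics.QuantumFieldTheory.BalabanImbrieJaffe1984to88.BIJ88HolderDecay213

/-!
# `BalabanImbrieJaffe1984to88.BIJ88HolderDecay230` — T. Bałaban, J. Imbrie, A. Jaffe, *Effective action and cluster properties of the
abelian Higgs model*, Commun. Math. Phys. **114** (1988) 257–315 [BalabanImbrieJaffe1988]: the sentence of p. 263 after (2.33), *"Bounds
analogous to (2.30), (2.31) hold for covariant derivatives and Hölder derivatives of G_{k,loc}(u) of order less than two"* — PROVED as a
hence-step over r18's real kernels (`applyK`/`supNorm`/`suppDist`): a single-scale kernel with the (2.30)-type sup bound and a Lipschitz bound in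
the output point has Hölder-θ quotients (0 ≤ θ ≤ 1) of its operator decaying like (2.30), and the same with the small prefactor of (2.31) for the
difference `G_{k,loc}(u) − G_k(Ω,u)`; the covariant difference differs from the plain one by `|u − 1|` times the function bound

statement-level skeleton of published theorems with citation tags; proofs where landed; nothing here is a claim about the Yang–Mills mass gap

PDF held: `paper:balaban1988-cmp114-bij-abelian-higgs-effective-action` (journal page = PDF page + 256); p. 263 [PDF 7] read this session as an
image rendered from the held PDF (seat folder `renders/bij88-p007.png`) and from the text layer.

WHAT IS REPRODUCED.  The located sentence of p. 263 attached to SKELETON rows **C2.Eq2.30** / **C2.Eq2.31** (cell `lit-balaban`, HOME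
`run/shared/lean/pub/lit-balaban/`; Phase-2 seat p08 gen 6 = unit `lit-balaban-p08`, own-lane free target after the seat's (2.13) analogue
`BIJ88HolderDecay213` (p251843/p252426, row C2.Eq2.13 second clause); C2 §§1–4 fold owner r18, referee ref-5; (2.30)/(2.31) themselves are p02's
`BIJ88OpDecay230Proof` (p248817) and are NOT touched).  p. 263 [PDF 7], verbatim: *"a straightforward application of the random walk expansion of
[6] shows that |(G_{k,loc}(u)f)(x)| ≦ ce^{−c dist(suppt f,x)}‖f‖_∞, (2.30) |(G_{k,loc}(u)f − G_k(Ω,u)f)(x)| ≦ e^{−cr(e_k)}e^{−c dist(suppt f,x)}‖f‖_∞, (2.31)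
for dist(x,Ω^c) ≧ O(r(e_k)). … Bounds analogous to (2.30), (2.31) hold for covariant derivatives and Hölder derivatives of G_{k,loc}(u) of order
less than two."*

WHAT IS PROVED HERE (0 `sorry`, standard axioms; theorems only, kind «hence-step»).  The inputs are DISPLAYED HYPOTHESES on an abstract kernel
`G(x,y)` (output x, input y): the (2.30)-type row bound `|G(x,y)| ≤ Ae^{−δ dist(y,x)}`, a LIPSCHITZ bound in the output point
`|G(x,y) − G(x′,y)| ≤ A·M·sep(x,x′)·e^{−δ min{dist(y,x),dist(y,x′)}}` (M = the inverse length of the scale — [6]'s derivative estimate for the Neumann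
propagators behind (2.27)–(2.28), not derived here), and row sums `Σ_y e^{−(δ/2)dist(y,x)} ≤ S`.
§1 **`holderKernel_single`** (`|G(x,y) − G(x′,y)| ≤ 2^{1−θ}AM^θ sep^θ e^{−δ min}`, 0 ≤ θ ≤ 1; `BIJ88HolderDecay213.abs_sub_le_holder`),
`applyK_kernel_sub`.
§2 «Hölder derivatives … of order less than two», THE (2.30) ANALOGUE: **`holderOpDecay230`**
(`|(Gf)(x) − (Gf)(x′)| ≤ 2^{1−θ}AM^θ·sep(x,x′)^θ·2S·e^{−(δ/2)dist(suppt f,{x,x′})}‖f‖_∞`, the pair distance `min` as in `BIJ88HolderDecay213`),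
the θ = 1 endpoint **`differenceOpDecay230`** (plain lattice derivative = difference quotient at separation `sep`).
§3 THE (2.31) ANALOGUE **`holderOpClose231`**: the same for the difference kernel `E = G_{k,loc}(u) − G_k(Ω,u)` with prefactor `ε` (print:
`ε = e^{−cr(e_k)}`) and the region condition `Far` («dist(x,Ω^c) ≧ O(r(e_k))») on both output points; `holderOpClose231_rek`.
§4 «covariant derivatives»: **`abs_covDiff_le`** (`|c(u·a − b)| ≤ |c|(|a − b| + |u − 1||a|)`) and **`covDerivOpDecay230`** — the covariant
derivative `c(u_b(Gf)(b₊) − (Gf)(b₋))` of `Gf` across a bond is bounded by the plain difference bound of §2 plus `|u_b − 1|` times the (2.30) bound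
(abelian `u_b` read as a real weight in r18's real typing; for `|u_b| = 1` complex phases the same algebra holds verbatim).
HONEST SCOPE.  [6]'s sup and derivative estimates for the Neumann propagators, the smoothness (2.32) of `u`, and (2.30)/(2.31) themselves stay
displayed hypotheses / p02's theorems; «order less than two» = one derivative plus a Hölder quotient of order θ < 1 of it is NOT typed beyond the
first-order-plus-θ pattern above (the second output-point difference of a first-derivative kernel is the same lemma applied to that kernel); constants
explicit, not optimised.  NOT summit progress.
-/

namespace Literature.MathematicalPhysics.QuantumFieldTheory.BalabanImbrieJaffe1984to88.BIJ88HolderDecay230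

open Finset BIJ88Sect2Statements BIJ88Close235Proof BIJ88OpDecay230Proof BIJ88HolderDecay213

noncomputable section

variable {α β : Type*}

/-! ## §1  One kernel, two output points: the Hölder interpolation -/

/-- A decay factor at the larger distance is at most the one at the pair distance `min`. [cite: BalabanImbrieJaffe1988, (2.30) p.263] -/
theorem exp_dist_le_exp_min_left {δ a b : ℝ} (hδ : 0 ≤ δ) : Real.exp (-δ * a) ≤ Real.exp (-δ * min a b) := by
  refine Real.exp_le_exp.2 ?_
  rw [neg_mul, neg_mul]
  exact neg_le_neg (mul_le_mul_of_nonneg_left (min_le_left a b) hδ)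

/-- The same for the second point. [cite: BalabanImbrieJaffe1988, (2.30) p.263] -/
theorem exp_dist_le_exp_min_right {δ a b : ℝ} (hδ : 0 ≤ δ) : Real.exp (-δ * b) ≤ Real.exp (-δ * min a b) := by
  rw [min_comm]
  exact exp_dist_le_exp_min_left hδ

/-- **Hölder interpolation for one kernel.**  Sup bounds `|G(x,y)|, |G(x′,y)| ≤ Ae^{−δ dist}` and the Lipschitz bound
`|G(x,y) − G(x′,y)| ≤ AM·sep(x,x′)·e^{−δ min{dist(y,x),dist(y,x′)}}` give, for every `0 ≤ θ ≤ 1`,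
`|G(x,y) − G(x′,y)| ≤ 2^{1−θ}AM^θ·sep(x,x′)^θ·e^{−δ min{dist(y,x),dist(y,x′)}}`. [cite: BalabanImbrieJaffe1988, (2.30) p.263] -/
theorem holderKernel_single {G : β → α → ℝ} {dist : α → β → ℝ} {sep : β → β → ℝ} {A M δ θ : ℝ} (hA : 0 ≤ A) (hM : 0 ≤ M)
    (hδ : 0 ≤ δ) (hθ0 : 0 ≤ θ) (hθ1 : θ ≤ 1) (hsep : ∀ x x', 0 ≤ sep x x') {x x' : β} {y : α}
    (hx : |G x y| ≤ A * Real.exp (-δ * dist y x)) (hx' : |G x' y| ≤ A * Real.exp (-δ * dist y x'))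
    (hlip : |G x y - G x' y| ≤ A * M * sep x x' * Real.exp (-δ * min (dist y x) (dist y x'))) :
    |G x y - G x' y| ≤ 2 ^ (1 - θ) * A * M ^ θ * sep x x' ^ θ * Real.exp (-δ * min (dist y x) (dist y x')) :=
  abs_sub_le_holder hA hM (hsep x x') (Real.exp_pos _).le hθ0 hθ1
    (hx.trans (mul_le_mul_of_nonneg_left (exp_dist_le_exp_min_left hδ) hA))
    (hx'.trans (mul_le_mul_of_nonneg_left (exp_dist_le_exp_min_right hδ) hA)) hlip

/-- Kernels act linearly: `((G − G′)f)(x) = (Gf)(x) − (G′f)(x)`. [cite: BalabanImbrieJaffe1988, (2.31) p.263] -/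
theorem applyK_kernel_sub [Fintype α] (G G' : β → α → ℝ) (f : α → ℝ) (x : β) :
    applyK (fun x y => G x y - G' x y) f x = applyK G f x - applyK G' f x := by
  simp only [applyK, sub_mul, sum_sub_distrib]

/-! ## §2  «Hölder derivatives of G_{k,loc}(u) of order less than two»: the (2.30) analogue -/

/-- **The (2.30) analogue for Hölder quotients, explicit constants.**  Under the (2.30)-type row bound, the Lipschitz bound in the output point and
the row sums `Σ_y e^{−(δ/2)dist(y,x)} ≤ S`: for all `f`, `x`, `x′` and every `0 ≤ θ ≤ 1`,
`|(Gf)(x) − (Gf)(x′)| ≤ 2^{1−θ}AM^θ·sep(x,x′)^θ·2S·e^{−(δ/2)dist(suppt f,{x,x′})}·‖f‖_∞` — the Hölder-θ quotient of `G_{k,loc}(u)f` decays like the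
function bound (2.30). [cite: BalabanImbrieJaffe1988, (2.30) p.263] -/
theorem holderOpDecay230 [Fintype α] {G : β → α → ℝ} {dist : α → β → ℝ} {sep : β → β → ℝ} {A M δ θ S : ℝ} (hA : 0 ≤ A)
    (hM : 0 ≤ M) (hδ : 0 ≤ δ) (hθ0 : 0 ≤ θ) (hθ1 : θ ≤ 1) (hsep : ∀ x x', 0 ≤ sep x x')
    (hsup : ∀ x y, |G x y| ≤ A * Real.exp (-δ * dist y x))
    (hlip : ∀ x x' y, |G x y - G x' y| ≤ A * M * sep x x' * Real.exp (-δ * min (dist y x) (dist y x')))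
    (hS : ∀ x, ∑ y, Real.exp (-(δ / 2) * dist y x) ≤ S) (f : α → ℝ) (x x' : β) :
    |applyK G f x - applyK G f x'| ≤ 2 ^ (1 - θ) * A * M ^ θ * sep x x' ^ θ * (2 * S)
        * Real.exp (-(δ / 2) * suppDist (fun y (p : β × β) => min (dist y p.1) (dist y p.2)) f (x, x')) * supNorm f := by
  rw [applyK_sub_applyK]
  have hA' : 0 ≤ 2 ^ (1 - θ) * A * M ^ θ * sep x x' ^ θ := by have := hsep x x'; positivity
  have hK : ∀ y, |G x y - G x' y| ≤ 2 ^ (1 - θ) * A * M ^ θ * sep x x' ^ θ * Real.exp (-δ * min (dist y x) (dist y x')) :=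
    fun y => holderKernel_single hA hM hδ hθ0 hθ1 hsep (hsup x y) (hsup x' y) (hlip x x' y)
  exact abs_applyK_le_of_kernel (dist := fun y (p : β × β) => min (dist y p.1) (dist y p.2))
    (K := fun (p : β × β) y => G p.1 y - G p.2 y) hA' hδ hK (sum_exp_min_le hS x x') f

/-- **The θ = 1 endpoint: plain lattice derivatives of `G_{k,loc}(u)f`** (difference quotient at separation `sep(x,x′)`):
`|(Gf)(x) − (Gf)(x′)| ≤ AM·sep(x,x′)·2S·e^{−(δ/2)dist(suppt f,{x,x′})}·‖f‖_∞`. [cite: BalabanImbrieJaffe1988, (2.30) p.263] -/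
theorem differenceOpDecay230 [Fintype α] {G : β → α → ℝ} {dist : α → β → ℝ} {sep : β → β → ℝ} {A M δ S : ℝ} (hA : 0 ≤ A)
    (hM : 0 ≤ M) (hδ : 0 ≤ δ) (hsep : ∀ x x', 0 ≤ sep x x') (hsup : ∀ x y, |G x y| ≤ A * Real.exp (-δ * dist y x))
    (hlip : ∀ x x' y, |G x y - G x' y| ≤ A * M * sep x x' * Real.exp (-δ * min (dist y x) (dist y x')))
    (hS : ∀ x, ∑ y, Real.exp (-(δ / 2) * dist y x) ≤ S) (f : α → ℝ) (x x' : β) :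
    |applyK G f x - applyK G f x'| ≤ A * M * sep x x' * (2 * S)
        * Real.exp (-(δ / 2) * suppDist (fun y (p : β × β) => min (dist y p.1) (dist y p.2)) f (x, x')) * supNorm f := by
  have h := holderOpDecay230 hA hM hδ zero_le_one le_rfl hsep hsup hlip hS f x x'
  simpa only [Real.rpow_one, sub_self, Real.rpow_zero, one_mul] using h

/-! ## §3  The (2.31) analogue: Hölder quotients of `G_{k,loc}(u)f − G_k(Ω,u)f` carry the small prefactor -/

/-- **The (2.31) analogue.**  For the difference kernel `E = G_{k,loc}(u) − G_k(Ω,u)` with the closeness bound `|E(x,y)| ≤ εe^{−δ dist(y,x)}`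
and the Lipschitz bound `|E(x,y) − E(x′,y)| ≤ εM·sep·e^{−δ min}` at output points in the region `Far` («dist(x,Ω^c) ≧ O(r(e_k))»), and row sums
`≤ S`: for `Far x`, `Far x′`, `0 ≤ θ ≤ 1`,
`|((G_{k,loc}f)(x) − (G_kf)(x)) − ((G_{k,loc}f)(x′) − (G_kf)(x′))| ≤ 2^{1−θ}εM^θ·sep(x,x′)^θ·2S·e^{−(δ/2)dist(suppt f,{x,x′})}·‖f‖_∞`.
[cite: BalabanImbrieJaffe1988, (2.31) p.263] -/
theorem holderOpClose231 [Fintype α] {Gloc G : β → α → ℝ} {dist : α → β → ℝ} {sep : β → β → ℝ} {Far : β → Prop}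
    {ε M δ θ S : ℝ} (hε : 0 ≤ ε) (hM : 0 ≤ M) (hδ : 0 ≤ δ) (hθ0 : 0 ≤ θ) (hθ1 : θ ≤ 1) (hsep : ∀ x x', 0 ≤ sep x x')
    (hsup : ∀ x, Far x → ∀ y, |Gloc x y - G x y| ≤ ε * Real.exp (-δ * dist y x))
    (hlip : ∀ x x', Far x → Far x' → ∀ y,
      |(Gloc x y - G x y) - (Gloc x' y - G x' y)| ≤ ε * M * sep x x' * Real.exp (-δ * min (dist y x) (dist y x')))
    (hS : ∀ x, ∑ y, Real.exp (-(δ / 2) * dist y x) ≤ S) (f : α → ℝ) {x x' : β} (hx : Far x) (hx' : Far x') :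
    |(applyK Gloc f x - applyK G f x) - (applyK Gloc f x' - applyK G f x')|
      ≤ 2 ^ (1 - θ) * ε * M ^ θ * sep x x' ^ θ * (2 * S)
        * Real.exp (-(δ / 2) * suppDist (fun y (p : β × β) => min (dist y p.1) (dist y p.2)) f (x, x')) * supNorm f := by
  rw [← applyK_kernel_sub, ← applyK_kernel_sub, applyK_sub_applyK]
  have hA' : 0 ≤ 2 ^ (1 - θ) * ε * M ^ θ * sep x x' ^ θ := by have := hsep x x'; positivity
  have hK : ∀ y, |(Gloc x y - G x y) - (Gloc x' y - G x' y)|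
      ≤ 2 ^ (1 - θ) * ε * M ^ θ * sep x x' ^ θ * Real.exp (-δ * min (dist y x) (dist y x')) :=
    fun y => holderKernel_single (G := fun x y => Gloc x y - G x y) hε hM hδ hθ0 hθ1 hsep (hsup x hx y) (hsup x' hx' y)
      (hlip x x' hx hx' y)
  exact abs_applyK_le_of_kernel (dist := fun y (p : β × β) => min (dist y p.1) (dist y p.2))
    (K := fun (p : β × β) y => (Gloc p.1 y - G p.1 y) - (Gloc p.2 y - G p.2 y)) hA' hδ hK (sum_exp_min_le hS x x') f

/-- **The (2.31) analogue at print's prefactor** `ε = e^{−c′r(e_k)}`. [cite: BalabanImbrieJaffe1988, (2.31) p.263] -/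
theorem holderOpClose231_rek [Fintype α] {Gloc G : β → α → ℝ} {dist : α → β → ℝ} {sep : β → β → ℝ} {Far : β → Prop}
    {c' rek M δ θ S : ℝ} (hM : 0 ≤ M) (hδ : 0 ≤ δ) (hθ0 : 0 ≤ θ) (hθ1 : θ ≤ 1) (hsep : ∀ x x', 0 ≤ sep x x')
    (hsup : ∀ x, Far x → ∀ y, |Gloc x y - G x y| ≤ Real.exp (-c' * rek) * Real.exp (-δ * dist y x))
    (hlip : ∀ x x', Far x → Far x' → ∀ y, |(Gloc x y - G x y) - (Gloc x' y - G x' y)|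
      ≤ Real.exp (-c' * rek) * M * sep x x' * Real.exp (-δ * min (dist y x) (dist y x')))
    (hS : ∀ x, ∑ y, Real.exp (-(δ / 2) * dist y x) ≤ S) (f : α → ℝ) {x x' : β} (hx : Far x) (hx' : Far x') :
    |(applyK Gloc f x - applyK G f x) - (applyK Gloc f x' - applyK G f x')|
      ≤ 2 ^ (1 - θ) * Real.exp (-c' * rek) * M ^ θ * sep x x' ^ θ * (2 * S)
        * Real.exp (-(δ / 2) * suppDist (fun y (p : β × β) => min (dist y p.1) (dist y p.2)) f (x, x')) * supNorm f :=
  holderOpClose231 (Real.exp_pos _).le hM hδ hθ0 hθ1 hsep hsup hlip hS f hx hx'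

/-! ## §4  «covariant derivatives»: the covariant difference against the plain one -/

/-- The covariant difference `c(u·a − b)` differs from the plain one by `|u − 1||a|`: `|c(u·a − b)| ≤ |c|(|a − b| + |u − 1||a|)`.
[cite: BalabanImbrieJaffe1988, (2.30) p.263] -/
theorem abs_covDiff_le (c u a b : ℝ) : |c * (u * a - b)| ≤ |c| * (|a - b| + |u - 1| * |a|) := by
  rw [abs_mul]
  refine mul_le_mul_of_nonneg_left ?_ (abs_nonneg c)
  have h : u * a - b = (a - b) + (u - 1) * a := by ring
  rw [h, ← abs_mul]
  exact abs_add_le _ _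

/-- **The (2.30) analogue for the covariant derivative of `G_{k,loc}(u)f` across a bond** `b = ⟨b₋, b₊⟩` (lattice factor `c`, parallel
transport weight `u` with `|u − 1| ≤ υ`): from the difference bound `X` of §2 (θ = 1) and the function bound `Y` of (2.30) at `b₊`,
`|c(u(Gf)(b₊) − (Gf)(b₋))| ≤ |c|(X + υY)`. [cite: BalabanImbrieJaffe1988, (2.30) p.263] -/
theorem covDerivOpDecay230 [Fintype α] {G : β → α → ℝ} {f : α → ℝ} {bplus bminus : β} {c u υ X Y : ℝ}
    (hX : |applyK G f bplus - applyK G f bminus| ≤ X) (hY : |applyK G f bplus| ≤ Y) (hu : |u - 1| ≤ υ) :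
    |c * (u * applyK G f bplus - applyK G f bminus)| ≤ |c| * (X + υ * Y) := by
  refine (abs_covDiff_le c u _ _).trans (mul_le_mul_of_nonneg_left ?_ (abs_nonneg c))
  exact add_le_add hX (mul_le_mul hu hY (abs_nonneg _) ((abs_nonneg _).trans hu))

/-- **The covariant derivative bound assembled** from `differenceOpDecay230` and p02's (2.30) mechanism `abs_applyK_le_of_kernel`: with the
row bound `A`, the Lipschitz constant `AM`, row sums `S` (rate δ/2) and `|u − 1| ≤ υ`,
`|c(u(Gf)(b₊) − (Gf)(b₋))| ≤ |c|·(AM·sep(b₊,b₋)·2S·e^{−(δ/2)dist(suppt f,{b₊,b₋})} + υ·AS·e^{−(δ/2)dist(suppt f,b₊)})·‖f‖_∞`.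
[cite: BalabanImbrieJaffe1988, (2.30) p.263] -/
theorem covDerivOpDecay230_explicit [Fintype α] {G : β → α → ℝ} {dist : α → β → ℝ} {sep : β → β → ℝ} {A M δ S c u υ : ℝ}
    (hA : 0 ≤ A) (hM : 0 ≤ M) (hδ : 0 ≤ δ) (hsep : ∀ x x', 0 ≤ sep x x') (hsup : ∀ x y, |G x y| ≤ A * Real.exp (-δ * dist y x))
    (hlip : ∀ x x' y, |G x y - G x' y| ≤ A * M * sep x x' * Real.exp (-δ * min (dist y x) (dist y x')))
    (hS : ∀ x, ∑ y, Real.exp (-(δ / 2) * dist y x) ≤ S) (hu : |u - 1| ≤ υ) (f : α → ℝ) (bplus bminus : β) :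
    |c * (u * applyK G f bplus - applyK G f bminus)|
      ≤ |c| * (A * M * sep bplus bminus * (2 * S)
          * Real.exp (-(δ / 2) * suppDist (fun y (p : β × β) => min (dist y p.1) (dist y p.2)) f (bplus, bminus)) * supNorm f
        + υ * (A * S * Real.exp (-(δ / 2) * suppDist dist f bplus) * supNorm f)) :=
  covDerivOpDecay230 (differenceOpDecay230 hA hM hδ hsep hsup hlip hS f bplus bminus)
    (abs_applyK_le_of_kernel hA hδ (hsup bplus) (hS bplus) f) hu

end

end Literature.MathematicalPhysics.QuantumFieldTheory.BalabanImbrieJaffe1984to88.BIJ88HolderDecay230
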